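import Mathlib.RingTheory.Polynomial.Resultant.Basic
import Mathlib.RingTheory.Radical.Basic
import Mathlib.RingTheory.Polynomial.GaussLemma
import Mathlib.FieldTheory.SplittingField.Construction
import Mathlib.FieldTheory.Perfect
import Mathlib.RingTheory.Localization.FractionRing
import HarnessLib

/-!
# The midpoint resultant of a monic polynomial, and monic square-free parts

Two elementary constructions on monic univariate polynomials over a commutative ring `A`, used to
*augment* a real polynomial family by the midpoints of its complex roots (Jung's projection method
for resolving plane curve / surface singularities needs the real parts `(ρ + ρ̄)/2` of the complex
roots among the real "walls").

* **Midpoint resultant** (`map_eval_midpointResultant`, `natDegree_midpointResultant`,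
  `leadingCoeff_midpointResultant`). For `R ∈ A[T]` monic of degree `D` put
  `M(T) := Res_S (R(S), R(2T − S)) ∈ A[T]` (Sylvester resultant of size `D + D` in the variable
  `S`, computed in `A[T][S]`). For every ring map `φ : A → L` to a field over which `R` splits with
  roots `ρ₁, …, ρ_D` (with multiplicity) and every `t ∈ L`,
  `φ(M)(t) = ∏ᵢ ∏ⱼ (2t − (ρᵢ + ρⱼ))`: the roots of `M` are exactly the midpoints of pairs of roots
  of `R` (including the roots of `R` themselves). Over a domain of characteristic zero `M` has degree
  `D²` and leading coefficient `2^{D²}` (so `M` is monic up to a unit when `2` is invertible).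
  The computation is the textbook one: `Res(f, g) = ∏ (α − β)` over the roots for monic split
  `f`, `g` (Mathlib's `Polynomial.resultant_eq_prod_roots_sub`), base change of resultants
  (`Polynomial.resultant_map_map`), and `R(2t − S) = (−1)^D ∏ (S − (2t − ρⱼ))`.
* **Monic square-free part** (`exists_monic_squarefree_part`). Over an integrally closed domain `A`
  of characteristic zero, every monic `M ∈ A[T]` has a monic `P ∈ A[T]` with `P ∣ M`, `M ∣ P^m`
  for some `m`, and `Res(P, P') ≠ 0`: `P` is the radical of `M` in `K[T]`, `K = Frac A`
  (`UniqueFactorizationMonoid.radical`), which is monic and descends to `A[T]` because `A` is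
  integrally closed (`IsIntegrallyClosed.eq_map_mul_C_of_dvd`), and is separable since `K` is perfect
  (`PerfectField.separable_iff_squarefree`).

No new definitions are introduced: the midpoint resultant enters the statements through a
hypothesis `hM : M = (R.map C).resultant ((R.map C).comp (C (2 * X) - X)) R.natDegree R.natDegree`.

## References

* S. Basu, R. Pollack, M.-F. Roy, *Algorithms in Real Algebraic Geometry*, 2nd ed. (2006),
  §4.2 (resultant and roots, Thm. 4.16), §5.2.
* H. W. E. Jung, Darstellung der Funktionen eines algebraischen Körpers zweier unabhängigen
  Veränderlichen, J. reine angew. Math. 133 (1908) — the projection method.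
-/

noncomputable section

open Polynomial

namespace Literature.Algebra.Polynomial

section MidpointResultant

variable {A : Type*} [CommRing A]

/-- **Roots of the midpoint resultant.** For `R ∈ A[T]` monic of degree `D`,
`M = Res_S(R(S), R(2T − S))` (Sylvester resultant of format `D + D` in `A[T][S]`), a ring map
`φ : A → L` to a field over which `R` splits, and `t ∈ L`:
`φ(M)(t) = ∏_{ρ} ∏_{ρ'} (2t − (ρ + ρ'))`, the products over the roots of `φ(R)` with multiplicity.
[folklore] -/
theorem map_eval_midpointResultant {R M : A[X]} (hR : R.Monic)
    (hM : M = (R.map C).resultant ((R.map C).comp (C (2 * X) - X)) R.natDegree R.natDegree)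
    {L : Type*} [Field L] (φ : A →+* L) (hs : (R.map φ).Splits) (t : L) :
    (M.map φ).eval t = ((R.map φ).roots.map fun a =>
      ((R.map φ).roots.map fun b => 2 * t - (a + b)).prod).prod := by
  classical
  set D := R.natDegree with hD
  set φ' : A[X] →+* L := (evalRingHom t).comp (mapRingHom φ) with hφ'
  have hφ'C : φ'.comp C = φ := RingHom.ext fun a => by simp [hφ']
  have h1 : (M.map φ).eval t = φ' M := by simp [hφ']
  rw [h1, hM, ← resultant_map_map, Polynomial.map_comp, Polynomial.map_map, hφ'C]
  have h2 : (C (2 * X) - X : A[X][X]).map φ' = C (2 * t) - X := by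
    simp [hφ', Polynomial.map_sub]
  rw [h2]
  set s := (R.map φ).roots with hs_def
  have hRφ : (R.map φ).Monic := hR.map φ
  have hprod : R.map φ = (s.map fun a => X - C a).prod := hs.eq_prod_roots_of_monic hRφ
  have hcard : s.card = D := by
    rw [hs_def, ← hs.natDegree_eq_card_roots, hR.natDegree_map]
  -- `R(2t - S) = (-1)^D ∏ (S - (2t - ρ))`
  have hcomp : (R.map φ).comp (C (2 * t) - X) =
      C ((-1) ^ D) * ((s.map fun a => 2 * t - a).map fun b => X - C b).prod := by
    rw [hprod, multiset_prod_comp, Multiset.map_map, Multiset.map_map]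
    have : (s.map ((fun p : L[X] => p.comp (C (2 * t) - X)) ∘ fun a => X - C a)) =
        (s.map ((fun b => X - C b) ∘ fun a => 2 * t - a)).map Neg.neg := by
      rw [Multiset.map_map]
      refine Multiset.map_congr rfl fun a _ => ?_
      simp only [Function.comp_apply, sub_comp, X_comp, C_comp, map_sub, map_mul]
      ring
    rw [this, Multiset.prod_map_neg, Multiset.card_map, hcard, map_pow, map_neg, map_one]
  have hmonic₂ : ((s.map fun a => 2 * t - a).map fun b => X - C b).prod.Monic :=
    monic_multiset_prod_of_monic _ _ fun b _ => monic_X_sub_C b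
  have hdeg₁ : (s.map fun a => X - C a).prod.natDegree = D := by
    rw [natDegree_multiset_prod_X_sub_C_eq_card, hcard]
  have hdeg₂ : ((s.map fun a => 2 * t - a).map fun b => X - C b).prod.natDegree = D := by
    rw [natDegree_multiset_prod_X_sub_C_eq_card, Multiset.card_map, hcard]
  rw [hcomp, resultant_C_mul_right, hprod]
  have hres := resultant_eq_prod_roots_sub (s.map fun a => X - C a).prod
    ((s.map fun a => 2 * t - a).map fun b => X - C b).prod
    (monic_multiset_prod_of_monic _ _ fun b _ => monic_X_sub_C b) hmonic₂
    (Splits.multisetProd fun p hp => by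
      obtain ⟨b, -, rfl⟩ := Multiset.mem_map.1 hp
      exact Splits.X_sub_C b)
    (Splits.multisetProd fun p hp => by
      obtain ⟨b, -, rfl⟩ := Multiset.mem_map.1 hp
      exact Splits.X_sub_C b)
  rw [hdeg₁, hdeg₂] at hres
  rw [hres, roots_multiset_prod_X_sub_C, roots_multiset_prod_X_sub_C]
  -- bookkeeping of the double product (`Multiset.prod_map_product_eq_prod_prod`)
  rw [Multiset.prod_map_product_eq_prod_prod]
  have h3 : ∀ a : L, ((s.map fun a => 2 * t - a).map fun b => (a, b).1 - (a, b).2).prod =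
      (-1) ^ D * (s.map fun b => 2 * t - (a + b)).prod := fun a => by
    have : ((s.map fun a => 2 * t - a).map fun b => (a, b).1 - (a, b).2) =
        (s.map fun b => 2 * t - (a + b)).map Neg.neg := by
      rw [Multiset.map_map, Multiset.map_map]
      exact Multiset.map_congr rfl fun b _ => by simp only [Function.comp_apply]; ring
    rw [this, Multiset.prod_map_neg, Multiset.card_map, hcard]
  simp only [h3, Multiset.prod_map_mul, Multiset.map_const', Multiset.prod_replicate, hcard]
  rw [← mul_assoc, ← mul_pow, ← mul_pow]
  norm_num

/-- **Degree of the midpoint resultant.** Over a domain of characteristic zero, the midpoint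
resultant `M = Res_S(R(S), R(2T − S))` of a monic `R` of degree `D` has degree `D²` and leading
coefficient `2^{D²}` (base change to a splitting field, where `M = ∏ᵢⱼ (2T − (ρᵢ + ρⱼ))`).
[folklore] -/
theorem natDegree_midpointResultant [IsDomain A] [CharZero A] {R M : A[X]} (hR : R.Monic)
    (hM : M = (R.map C).resultant ((R.map C).comp (C (2 * X) - X)) R.natDegree R.natDegree) :
    M.natDegree = R.natDegree ^ 2 ∧ M.leadingCoeff = 2 ^ (R.natDegree ^ 2) := by
  classical
  set D := R.natDegree with hD
  let K := FractionRing A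
  let L := (R.map (algebraMap A K)).SplittingField
  let φ : A →+* L := (algebraMap K L).comp (algebraMap A K)
  have hφ : Function.Injective φ :=
    (algebraMap K L).injective.comp (IsFractionRing.injective A K)
  haveI : CharZero L := charZero_of_injective_algebraMap (algebraMap K L).injective
  have hs : (R.map φ).Splits := by
    have h := SplittingField.splits (R.map (algebraMap A K))
    rwa [Polynomial.map_map] at h
  set s := (R.map φ).roots with hs_def
  have hcard : s.card = D := by
    rw [hs_def, ← hs.natDegree_eq_card_roots, hR.natDegree_map]
  -- the split form of `M` over `L`
  set Qm : L[X] := (s.map fun a => (s.map fun b => X - C ((a + b) / 2)).prod).prod with hQm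
  have hQm_monic : Qm.Monic := monic_multiset_prod_of_monic _ _ fun a _ =>
    monic_multiset_prod_of_monic _ _ fun b _ => monic_X_sub_C _
  have hQm_deg : Qm.natDegree = D ^ 2 := by
    rw [hQm, natDegree_multiset_prod_of_monic _ fun p hp => ?_]
    · rw [Multiset.map_map]
      have : (s.map (natDegree ∘ fun a => (s.map fun b => X - C ((a + b) / 2)).prod)) =
          s.map (Function.const L D) := Multiset.map_congr rfl fun a _ => by
        rw [Function.comp_apply, Function.const_apply, natDegree_multiset_prod_of_monic]
        · rw [Multiset.map_map]
          have h1 : s.map (natDegree ∘ fun b => X - C ((a + b) / 2)) = s.map (Function.const L 1) :=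
            Multiset.map_congr rfl fun b _ => by simp
          rw [h1, Multiset.map_const, Multiset.sum_replicate, smul_eq_mul, mul_one, hcard]
        · intro q hq
          obtain ⟨b, -, rfl⟩ := Multiset.mem_map.1 hq
          exact monic_X_sub_C _
      rw [this, Multiset.map_const, Multiset.sum_replicate, hcard, smul_eq_mul, sq]
    · obtain ⟨a, -, rfl⟩ := Multiset.mem_map.1 hp
      exact monic_multiset_prod_of_monic _ _ fun b _ => monic_X_sub_C _
  have h2 : (2 : L) ≠ 0 := two_ne_zero
  haveI : Infinite L := Infinite.of_injective ((↑) : ℕ → L) Nat.cast_injective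
  have hMQ : M.map φ = C ((2 : L) ^ (D ^ 2)) * Qm := by
    apply Polynomial.funext
    intro t
    rw [map_eval_midpointResultant hR hM φ hs t, eval_mul, eval_C, hQm, eval_multiset_prod,
      Multiset.map_map]
    have inner : ∀ a : L, (s.map fun b => 2 * t - (a + b)).prod =
        2 ^ D * ((s.map fun b => X - C ((a + b) / 2)).prod).eval t := fun a => by
      rw [eval_multiset_prod, Multiset.map_map]
      have : (s.map fun b => 2 * t - (a + b)) =
          s.map fun b => 2 * ((eval t) ∘ fun b => X - C ((a + b) / 2)) b :=
        Multiset.map_congr rfl fun b _ => by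
          simp only [Function.comp_apply, eval_sub, eval_X, eval_C]
          ring
      rw [this, Multiset.prod_map_mul, Multiset.map_const', Multiset.prod_replicate, hcard]
    have : (s.map fun a => (s.map fun b => 2 * t - (a + b)).prod) =
        s.map fun a => 2 ^ D * ((eval t) ∘ fun a =>
          (s.map fun b => X - C ((a + b) / 2)).prod) a :=
      Multiset.map_congr rfl fun a _ => inner a
    rw [this, Multiset.prod_map_mul, Multiset.map_const', Multiset.prod_replicate, hcard, ← pow_mul,
      ← sq]
  have hdegL : (M.map φ).natDegree = D ^ 2 := by
    rw [hMQ, natDegree_C_mul (pow_ne_zero _ h2), hQm_deg]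
  have hlcL : (M.map φ).leadingCoeff = (2 : L) ^ (D ^ 2) := by
    rw [hMQ, leadingCoeff_mul, leadingCoeff_C, hQm_monic.leadingCoeff, mul_one]
  refine ⟨by rw [← natDegree_map_eq_of_injective hφ, hdegL], hφ ?_⟩
  rw [← leadingCoeff_map_of_injective hφ, hlcL, map_pow, map_ofNat]

end MidpointResultant

section SquarefreePart

variable {A : Type*} [CommRing A] [IsDomain A] [IsIntegrallyClosed A] [CharZero A]

/-- **Monic square-free part with non-zero discriminant.** Over an integrally closed domain `A` of
characteristic zero, every monic `M ∈ A[T]` admits a monic `P ∈ A[T]` with the same prime divisors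
(`P ∣ M`, `M ∣ P ^ m`) and `Res(P, P') ≠ 0` (Sylvester format `deg P + (deg P − 1)`): the radical of
`M` over `K = Frac A` is monic, hence lies in `A[T]` (Gauss / integral closedness), and is separable
because `K` is perfect. [folklore] -/
theorem exists_monic_squarefree_part (M : A[X]) (hM : M.Monic) :
    ∃ P : A[X], P.Monic ∧ P ∣ M ∧ (∃ m : ℕ, M ∣ P ^ m) ∧
      P.resultant (derivative P) P.natDegree (P.natDegree - 1) ≠ 0 := by
  classical
  let K := FractionRing A
  have hinj : Function.Injective (algebraMap A K) := IsFractionRing.injective A K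
  set MK := M.map (algebraMap A K) with hMK_def
  have hMK : MK.Monic := hM.map _
  have hMK0 : MK ≠ 0 := hMK.ne_zero
  set r := UniqueFactorizationMonoid.radical MK with hr_def
  have hrmonic : r.Monic := by
    rw [hr_def, UniqueFactorizationMonoid.radical]
    refine monic_prod_of_monic _ _ fun p hp => ?_
    have hp' := UniqueFactorizationMonoid.mem_primeFactors.1 hp
    have hp0 : p ≠ 0 := (UniqueFactorizationMonoid.prime_of_normalized_factor p hp').ne_zero
    rw [id, ← UniqueFactorizationMonoid.normalize_normalized_factor p hp']
    exact monic_normalize hp0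
  obtain ⟨P, hP⟩ := IsIntegrallyClosed.eq_map_mul_C_of_dvd K hM
    (UniqueFactorizationMonoid.radical_dvd_self : r ∣ MK)
  rw [hrmonic.leadingCoeff, C_1, mul_one, ← hr_def] at hP
  have hPmonic : P.Monic := monic_of_injective hinj (hP ▸ hrmonic)
  refine ⟨P, hPmonic, ?_, ?_, fun h0 => ?_⟩
  · rw [← map_dvd_map _ hinj hPmonic, hP]
    exact UniqueFactorizationMonoid.radical_dvd_self
  · obtain ⟨m, hm⟩ := UniqueFactorizationMonoid.exists_dvd_radical_self_pow hMK0
    exact ⟨m, (map_dvd_map _ hinj hM).1 (by rwa [Polynomial.map_pow, hP])⟩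
  · have hsep : r.Separable :=
      PerfectField.separable_iff_squarefree.2 UniqueFactorizationMonoid.squarefree_radical
    have hunit : IsUnit (resultant r (derivative r)) :=
      (isUnit_resultant_iff_isCoprime hrmonic).2 hsep
    have hdeg : r.natDegree = P.natDegree := by rw [← hP, hPmonic.natDegree_map]
    have hdeg' : (derivative r).natDegree = P.natDegree - 1 := by
      rw [natDegree_derivative, hdeg]
    have key : resultant r (derivative r) =
        algebraMap A K (P.resultant (derivative P) P.natDegree (P.natDegree - 1)) := by
      rw [← resultant_map_map, ← Polynomial.derivative_map, hP, ← hdeg', ← hdeg]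
    rw [key, h0, map_zero] at hunit
    exact not_isUnit_zero hunit

end SquarefreePart

end Literature.Algebra.Polynomial
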